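import Literature.MathematicalPhysics.QuantumFieldTheory.PeriodicBoxPlaqSystem
import Literature.MathematicalPhysics.QuantumFieldTheory.PlaqSystemLocalIso
import Literature.GroupTheory.CombinatorialGroupTheory.RandomSclFreeGroupProofs
import HarnessLib

/-!
# Translations of the periodic box: invariance of activities and truncated functionals

Sequel of `PeriodicBoxPlaqSystem` and `PlaqSystemLocalIso`. The translation `BoxLabel.rot i s` by `s`
in the `i`-th coordinate of the anisotropic periodic box of sizes `n` is a global symmetry of the box
plaquette system `boxSystem ρ n`: with the bond relabelling `boxEdgeRot n i s` it satisfies the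
hypotheses `h1`–`h4` of `PlaqSystemLocalIso` on the whole label set (`bonds_rot`,
`injOn_boxEdgeRot`, `cost_rot`, `BoxLabel.rot_injective`). Consequently the polymer activities,
the geometric incompatibility, the cluster property, the total size and the truncated functional
`Φ^T` of the strong-coupling cluster expansion are invariant under the induced action
`𝒞 ↦ 𝒞.image (image (rot i s))` on finite families of polymers
(`truncatedWeight_rotFamily`, `isPolymerCluster_rotFamily_iff`, …), and the coordinates transform
as `coord i (rot i s p) = (coord i p + s) mod nᵢ`, `coord j (rot i s p) = coord j p` (`j ≠ i`).
This is the translation invariance behind the extensivity of the finite-volume free energy on a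
periodic box (Seiler LNP 159, Ch. 2). Everything is proved; no named facts; no new definitions.

## References

* E. Seiler, LNP 159 (1982), Ch. 2 (periodic boundary conditions, symmetries). [SeilerLNP1982]
* K. Osterwalder, E. Seiler, Ann. Phys. 110 (1978) 440–471, §§2–3. [OsterwalderSeilerAnnPhys1978]
-/

noncomputable section

open MeasureTheory Finset
open Literature.Probability.LatticeModels

namespace Literature.MathematicalPhysics.QuantumFieldTheory

variable {d : ℕ} {n : Fin d → ℕ}

/-! ### Iterated rotations of `Fin k` (the value of `finRotate` itself is the tree's
`Literature.GroupTheory.CombinatorialGroupTheory.val_finRotate`) -/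

/-- The value of an iterated `finRotate`: `(x + s) mod k`. [folklore] -/
theorem val_finRotate_iterate {k : ℕ} (hk : 0 < k) (s : ℕ) (x : Fin k) :
    (((finRotate k)^[s] x : Fin k) : ℕ) = (x + s) % k := by
  induction s with
  | zero => simp [Nat.mod_eq_of_lt x.isLt]
  | succ s ih =>
    rw [Function.iterate_succ_apply', Literature.GroupTheory.CombinatorialGroupTheory.val_finRotate hk, ih,
      Nat.mod_add_mod, Nat.add_assoc]

/-- Iterating `finRotate k` `k` times is the identity. [folklore] -/
theorem finRotate_iterate_self {k : ℕ} (x : Fin k) : (finRotate k)^[k] x = x := by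
  rcases Nat.eq_zero_or_pos k with rfl | hk
  · exact x.elim0
  · refine Fin.ext ?_
    rw [val_finRotate_iterate hk, Nat.add_mod_right, Nat.mod_eq_of_lt x.isLt]

/-- Iterated rotations compose additively. [folklore] -/
theorem finRotate_iterate_add {k : ℕ} (a b : ℕ) (x : Fin k) :
    (finRotate k)^[a] ((finRotate k)^[b] x) = (finRotate k)^[a + b] x := by
  rw [Function.iterate_add_apply]

namespace BoxSite

/-! ### Rotations of sites -/

/-- The `i`-th coordinate of a rotated site. [folklore] -/
theorem rot_apply_self (i : Fin d) (s : ℕ) (x : BoxSite n) : rot i s x i = (finRotate (n i))^[s] (x i) := by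
  simp [rot]

/-- The other coordinates of a rotated site. [folklore] -/
theorem rot_apply_of_ne {i j : Fin d} (h : j ≠ i) (s : ℕ) (x : BoxSite n) : rot i s x j = x j := by
  simp [rot, Function.update_of_ne h]

/-- Rotation by `0` is the identity. [folklore] -/
@[simp] theorem rot_zero (i : Fin d) (x : BoxSite n) : rot i 0 x = x := by
  funext j
  by_cases h : j = i
  · subst h; simp [rot]
  · rw [rot_apply_of_ne h]

/-- Rotations in one coordinate compose additively. [folklore] -/
theorem rot_rot (i : Fin d) (a b : ℕ) (x : BoxSite n) : rot i a (rot i b x) = rot i (a + b) x := by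
  funext j
  by_cases h : j = i
  · subst h; simp only [rot_apply_self, finRotate_iterate_add]
  · simp only [rot_apply_of_ne h]

/-- Rotation by the size is the identity. [folklore] -/
@[simp] theorem rot_size (i : Fin d) (x : BoxSite n) : rot i (n i) x = x := by
  funext j
  by_cases h : j = i
  · subst h; rw [rot_apply_self, finRotate_iterate_self]
  · rw [rot_apply_of_ne h]

/-- Rotations are injective. [folklore] -/
theorem rot_injective (i : Fin d) (s : ℕ) : Function.Injective (rot (n := n) i s) := by
  intro x y hxy
  funext j
  have hj := congrFun hxy j
  by_cases h : j = i
  · subst h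
    rw [rot_apply_self, rot_apply_self] at hj
    exact (finRotate (n j)).injective.iterate s hj
  · rwa [rot_apply_of_ne h, rot_apply_of_ne h] at hj

/-- **Rotations commute with the shifts.** [folklore] -/
theorem shift_rot (μ i : Fin d) (s : ℕ) (x : BoxSite n) : shift μ (rot i s x) = rot i s (shift μ x) := by
  funext j
  by_cases hμi : μ = i
  · subst hμi
    by_cases hj : j = μ
    · subst hj
      simp only [shift, rot, Function.update_self]
      rw [← Function.iterate_succ_apply' (finRotate (n j)), Function.iterate_succ_apply]
    · simp [shift, rot, Function.update_of_ne hj]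
  · by_cases hj : j = μ
    · subst hj; simp [shift, rot, Function.update_of_ne hμi]
    · by_cases hji : j = i
      · subst hji; simp [shift, rot, Function.update_of_ne hj]
      · simp [shift, rot, Function.update_of_ne hj, Function.update_of_ne hji]

/-- **The section intertwines rotations of sites and the bond relabelling `boxEdgeRot`.** [folklore] -/
theorem toEdge_rot (i : Fin d) (s : ℕ) (x : BoxSite n) (μ : Fin d) :
    toEdge (rot i s x) μ = boxEdgeRot n i s (toEdge x μ) := by
  have hn : 0 < n i := by
    rcases Nat.eq_zero_or_pos (n i) with h0 | h0
    · exact ((x i).cast h0).elim0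
    · exact h0
  refine Prod.ext ?_ rfl
  funext j
  simp only [toEdge_fst_apply, boxEdgeRot, toEdge_snd]
  by_cases hj : j = i
  · subst hj
    rw [Function.update_self, rot_apply_self, val_finRotate_iterate hn, Int.toNat_natCast]
  · rw [Function.update_of_ne hj, rot_apply_of_ne hj, toEdge_fst_apply]

end BoxSite

namespace BoxLabel

/-! ### Rotations of labels: coordinates, bonds, costs -/

/-- The `i`-th coordinate of a rotated label: `(coord i p + s) mod nᵢ`. [folklore] -/
theorem coord_rot_self (i : Fin d) (s : ℕ) (p : BoxLabel n) : coord i (rot i s p) = (coord i p + s) % n i := by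
  have hn : 0 < n i := by
    rcases Nat.eq_zero_or_pos (n i) with h0 | h0
    · exact ((p.1 i).cast h0).elim0
    · exact h0
  simp only [coord, rot, BoxSite.rot_apply_self, val_finRotate_iterate hn]

/-- The other coordinates of a rotated label are unchanged. [folklore] -/
theorem coord_rot_of_ne {i j : Fin d} (h : j ≠ i) (s : ℕ) (p : BoxLabel n) : coord j (rot i s p) = coord j p := by
  simp only [coord, rot, BoxSite.rot_apply_of_ne h]

/-- Rotations of labels compose additively. [folklore] -/
theorem rot_rot (i : Fin d) (a b : ℕ) (p : BoxLabel n) : rot i a (rot i b p) = rot i (a + b) p := by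
  simp only [rot, BoxSite.rot_rot]

/-- Rotation of labels by the size is the identity. [folklore] -/
@[simp] theorem rot_size (i : Fin d) (p : BoxLabel n) : rot i (n i) p = p := by
  simp only [rot, BoxSite.rot_size]

/-- Rotation of labels by `0` is the identity. [folklore] -/
@[simp] theorem rot_zero (i : Fin d) (p : BoxLabel n) : rot i 0 p = p := by
  simp only [rot, BoxSite.rot_zero]

/-- **Rotations of labels are injective** (hypothesis `h4`). [folklore] -/
theorem rot_injective (i : Fin d) (s : ℕ) : Function.Injective (rot (n := n) i s) := by
  rintro ⟨x, q⟩ ⟨y, q'⟩ h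
  simp only [rot, Prod.mk.injEq] at h
  rw [BoxSite.rot_injective i s h.1, h.2]

/-- **The bonds of a rotated label are the relabelled bonds** (hypothesis `h1`). [folklore] -/
theorem bonds_rot (i : Fin d) (s : ℕ) (p : BoxLabel n) : (rot i s p).bonds = p.bonds.image (boxEdgeRot n i s) := by
  simp only [bonds, rot, Finset.image_insert, Finset.image_singleton, BoxSite.shift_rot, BoxSite.toEdge_rot]

variable {G : Type*} [Group G] {N : ℕ} (ρ : G →* Matrix (Fin N) (Fin N) ℂ)

/-- **The cost of a rotated label is the cost read through the relabelling** (hypothesis `h3`).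
[folklore] -/
theorem cost_rot (i : Fin d) (s : ℕ) (p : BoxLabel n) (U : ZdGaugeConfig d G) :
    cost ρ (rot i s p) U = cost ρ p (U ∘ boxEdgeRot n i s) := by
  simp only [cost, rot, BoxSite.shift_rot, BoxSite.toEdge_rot, Function.comp_apply]

end BoxLabel

/-- **The bond relabelling is injective on the box bonds** (hypothesis `h2`): every box bond is a
section `toEdge y μ`, on which `boxEdgeRot` acts as the (injective) rotation of `y`. [folklore] -/
theorem injOn_boxEdgeRot (i : Fin d) (s : ℕ) (A : Finset (BoxLabel n)) :
    Set.InjOn (boxEdgeRot n i s) (↑(A.biUnion BoxLabel.bonds) : Set (ZdEdge d)) := by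
  intro e he e' he' h
  rw [Finset.mem_coe, Finset.mem_biUnion] at he he'
  obtain ⟨p, -, hep⟩ := he
  obtain ⟨p', -, hep'⟩ := he'
  obtain ⟨y, μ, rfl⟩ := exists_eq_toEdge_of_mem_bonds hep
  obtain ⟨y', μ', rfl⟩ := exists_eq_toEdge_of_mem_bonds hep'
  rw [← BoxSite.toEdge_rot, ← BoxSite.toEdge_rot, BoxSite.toEdge_inj] at h
  rw [BoxSite.rot_injective i s h.1, h.2]

/-! ### Invariance of activities, polymers and clusters under rotations -/

section Invariance

variable {G : Type*} [Group G] {N : ℕ} {ρ : G →* Matrix (Fin N) (Fin N) ℂ}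
  [TopologicalSpace G] [IsTopologicalGroup G] [CompactSpace G] [MeasurableSpace G] [BorelSpace G]

omit [TopologicalSpace G] [IsTopologicalGroup G] [CompactSpace G] [MeasurableSpace G] [BorelSpace G] in
/-- Adjacency is rotation invariant. [folklore] -/
theorem boxSystem_adj_rot_iff (i : Fin d) (s : ℕ) (p q : BoxLabel n) :
    (boxSystem (G := G) ρ n).Adj (BoxLabel.rot i s p) (BoxLabel.rot i s q) ↔ (boxSystem (G := G) ρ n).Adj p q := by
  classical
  exact PlaqSystem.adj_map_iff (S := boxSystem (G := G) ρ n) (S' := boxSystem (G := G) ρ n) (A := {p, q})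
    (fun p _ => BoxLabel.bonds_rot i s p) (injOn_boxEdgeRot i s _) (by simp) (by simp)

omit [TopologicalSpace G] [IsTopologicalGroup G] [CompactSpace G] [MeasurableSpace G] [BorelSpace G] in
/-- Connectedness of label sets is rotation invariant. [folklore] -/
theorem isRConnected_rot_iff (i : Fin d) (s : ℕ) (Y : Finset (BoxLabel n)) :
    IsRConnected (boxSystem (G := G) ρ n).Adj (Y.image (BoxLabel.rot i s)) ↔
      IsRConnected (boxSystem (G := G) ρ n).Adj Y := by
  classical
  exact PlaqSystem.isRConnected_image_iff (S := boxSystem (G := G) ρ n) (S' := boxSystem (G := G) ρ n) (A := Y)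
    (fun p _ => BoxLabel.bonds_rot i s p) (injOn_boxEdgeRot i s _) (BoxLabel.rot_injective i s).injOn subset_rfl

omit [TopologicalSpace G] [IsTopologicalGroup G] [CompactSpace G] [MeasurableSpace G] [BorelSpace G] in
/-- Membership in the polymer set (nonempty connected label sets) is rotation invariant. [folklore] -/
theorem image_rot_mem_rconnSubsets_iff (i : Fin d) (s : ℕ) (Y : Finset (BoxLabel n)) :
    Y.image (BoxLabel.rot i s) ∈ rconnSubsets (boxSystem (G := G) ρ n).Adj Finset.univ ↔
      Y ∈ rconnSubsets (boxSystem (G := G) ρ n).Adj Finset.univ := by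
  classical
  simp only [mem_rconnSubsets, Finset.subset_univ, true_and, isRConnected_rot_iff]

/-- **The truncated functional is rotation invariant**: `Φ^T(rot 𝒞) = Φ^T(𝒞)` for every finite
family of polymers. [cite: SeilerLNP1982, Ch. 2] -/
theorem truncatedWeight_rotFamily (hρ : Continuous ρ) (i : Fin d) (s : ℕ) (𝒞 : Finset (Finset (BoxLabel n))) (β : ℂ) :
    truncatedWeight (GeomInc (boxSystem (G := G) ρ n).Adj)
        (connActivity (boxSystem (G := G) ρ n).Adj (zdHaar d G) ((boxSystem (G := G) ρ n).weight β))
        (𝒞.image (Finset.image (BoxLabel.rot i s))) =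
      truncatedWeight (GeomInc (boxSystem (G := G) ρ n).Adj)
        (connActivity (boxSystem (G := G) ρ n).Adj (zdHaar d G) ((boxSystem (G := G) ρ n).weight β)) 𝒞 := by
  classical
  exact PlaqSystem.truncatedWeight_image_image_eq (S := boxSystem (G := G) ρ n) (S' := boxSystem (G := G) ρ n)
    (A := Finset.univ) (boxSystem_regular ρ hρ n) (fun p _ => BoxLabel.bonds_rot i s p) (injOn_boxEdgeRot i s _)
    (fun p _ U => BoxLabel.cost_rot ρ i s p U) (BoxLabel.rot_injective i s).injOn (fun _ _ => Finset.subset_univ _) β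

omit [TopologicalSpace G] [IsTopologicalGroup G] [CompactSpace G] [MeasurableSpace G] [BorelSpace G] in
/-- **The cluster property is rotation invariant.** [folklore] -/
theorem isPolymerCluster_rotFamily_iff (i : Fin d) (s : ℕ) (𝒞 : Finset (Finset (BoxLabel n))) :
    IsPolymerCluster (GeomInc (boxSystem (G := G) ρ n).Adj) (𝒞.image (Finset.image (BoxLabel.rot i s))) ↔
      IsPolymerCluster (GeomInc (boxSystem (G := G) ρ n).Adj) 𝒞 := by
  classical
  exact PlaqSystem.isPolymerCluster_image_iff (S := boxSystem (G := G) ρ n) (S' := boxSystem (G := G) ρ n)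
    (A := Finset.univ) (fun p _ => BoxLabel.bonds_rot i s p) (injOn_boxEdgeRot i s _)
    (BoxLabel.rot_injective i s).injOn (fun _ _ => Finset.subset_univ _)

omit [TopologicalSpace G] [IsTopologicalGroup G] [CompactSpace G] [MeasurableSpace G] [BorelSpace G] in
/-- **The total size of a family of polymers is rotation invariant.** [folklore] -/
theorem sum_card_rotFamily (i : Fin d) (s : ℕ) (𝒞 : Finset (Finset (BoxLabel n))) :
    ∑ Y' ∈ 𝒞.image (Finset.image (BoxLabel.rot i s)), (Y'.card : ℝ) = ∑ Y ∈ 𝒞, (Y.card : ℝ) := by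
  classical
  exact PlaqSystem.sum_card_image_image (A := Finset.univ) (BoxLabel.rot_injective (n := n) i s).injOn
    (fun _ _ => Finset.subset_univ _)

omit [TopologicalSpace G] [IsTopologicalGroup G] [CompactSpace G] [MeasurableSpace G] [BorelSpace G] in
/-- The action on families of polymers is injective. [folklore] -/
theorem rotFamily_injective (i : Fin d) (s : ℕ) :
    Function.Injective fun 𝒞 : Finset (Finset (BoxLabel n)) => 𝒞.image (Finset.image (BoxLabel.rot i s)) :=
  Finset.image_injective (Finset.image_injective (BoxLabel.rot_injective i s))

omit [TopologicalSpace G] [IsTopologicalGroup G] [CompactSpace G] [MeasurableSpace G] [BorelSpace G] in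
/-- The actions on families of polymers compose additively. [folklore] -/
theorem rotFamily_rotFamily (i : Fin d) (a b : ℕ) (𝒞 : Finset (Finset (BoxLabel n))) :
    (𝒞.image (Finset.image (BoxLabel.rot i b))).image (Finset.image (BoxLabel.rot i a)) =
      𝒞.image (Finset.image (BoxLabel.rot i (a + b))) := by
  classical
  rw [Finset.image_image]
  congr 1
  funext Y
  simp only [Function.comp_apply, Finset.image_image]
  congr 1
  funext p
  exact BoxLabel.rot_rot i a b p

omit [TopologicalSpace G] [IsTopologicalGroup G] [CompactSpace G] [MeasurableSpace G] [BorelSpace G] in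
/-- The action by the size is the identity. [folklore] -/
@[simp] theorem rotFamily_size (i : Fin d) (𝒞 : Finset (Finset (BoxLabel n))) :
    𝒞.image (Finset.image (BoxLabel.rot i (n i))) = 𝒞 := by
  classical
  have h1 : (Finset.image (BoxLabel.rot (n := n) i (n i))) = id := by
    funext Y
    have : BoxLabel.rot (n := n) i (n i) = id := funext fun p => BoxLabel.rot_size i p
    rw [this, Finset.image_id]
    rfl
  rw [h1, Finset.image_id]

omit [TopologicalSpace G] [IsTopologicalGroup G] [CompactSpace G] [MeasurableSpace G] [BorelSpace G] in
omit [TopologicalSpace G] [IsTopologicalGroup G] [CompactSpace G] [MeasurableSpace G] [BorelSpace G] in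
/-- Rootedness in another coordinate is rotation invariant. [folklore] -/
theorem boxRooted_rotFamily_iff_of_ne {i j : Fin d} (h : j ≠ i) (s m : ℕ) (𝒞 : Finset (Finset (BoxLabel n))) :
    BoxRooted j m (𝒞.image (Finset.image (BoxLabel.rot i s))) ↔ BoxRooted j m 𝒞 := by
  classical
  unfold BoxRooted
  constructor
  · rintro ⟨h1, Y', hY', p', hp', h0⟩
    obtain ⟨Y, hY, rfl⟩ := Finset.mem_image.1 hY'
    obtain ⟨p, hp, rfl⟩ := Finset.mem_image.1 hp'
    rw [BoxLabel.coord_rot_of_ne h] at h0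
    refine ⟨fun Y hY p hp => ?_, Y, hY, p, hp, h0⟩
    have := h1 _ (Finset.mem_image_of_mem _ hY) _ (Finset.mem_image_of_mem _ hp)
    rwa [BoxLabel.coord_rot_of_ne h] at this
  · rintro ⟨h1, Y, hY, p, hp, h0⟩
    refine ⟨fun Y' hY' p' hp' => ?_, Y.image (BoxLabel.rot i s), Finset.mem_image_of_mem _ hY,
      BoxLabel.rot i s p, Finset.mem_image_of_mem _ hp, by rwa [BoxLabel.coord_rot_of_ne h]⟩
    obtain ⟨Y, hY, rfl⟩ := Finset.mem_image.1 hY'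
    obtain ⟨p, hp, rfl⟩ := Finset.mem_image.1 hp'
    rw [BoxLabel.coord_rot_of_ne h]
    exact h1 Y hY p hp

end Invariance

end Literature.MathematicalPhysics.QuantumFieldTheory
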